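import Literature.Probability.Percolation.FiveArmSite
import HarnessLib

/-!
# The five-arm site of the lowest crossing, III: the five arms

Topic `Literature/Probability/Percolation`; family `crit-perc`. PROOFS ONLY (no definition, no named
fact). Third brick of the separation-free proof of the two-radii five-arm lower bound (W. Werner,
PCMI 2009, Lecture 6, §3; P. Nolin, EJP 13 (2008), proof of Thm. 24 (ii) [arXiv 0711.4948:
Thm. 23 (ii), p. 17]); see `FiveArmFrontier.lean`, `FiveArmSite.lean`.

`exists_fiveArms` — **Nolin's five-arm site, deterministically.** In the parallelogram
`R = R(M, N)` with a configuration `ω` assume: an open and a closed left–right crossing of `R`; the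
top side unexplored by the exploration of the lowest open crossing (`explored M N ω`); an open path
off the explored set from the top side to a neighbour `g` (with `a₁ ≤ g₀ ≤ b₁`) of an explored site;
and a closed such path in the column `a₂ ≤ g₀ ≤ b₂` (`2 ≤ aᵢ`, `bᵢ + 2 ≤ M`). Then there are a site
`v` of the explored set (a site of the lowest crossing `κ`) and five connected site sets of `R`
started at neighbours of `v` — two open and one closed inside the explored set, one open and one
closed in the region above — pairwise disjoint, with the following reaches: the two open
"horizontal" arms (the two halves of `κ` at `v`) each contain a site of a vertical side of `R`
(`x₀ ∈ {0, M}`) and, unless `v` itself is within one column of `[a₁, b₁] ∪ [a₂, b₂]`, a site within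
one column of it (the feet of the two given paths lie on `κ`, on either side of `v`); the open and
the closed arm of the region above reach the top side; the closed arm below (the closed cluster of
the bottom side at `v`) reaches BOTH vertical sides, along the closed crossing, which it meets
because `v` is joined to the top side by an open path (`PathIn.tri_crossings_meet`). The double
foot `v` is `LowSeq.exists_doubleFoot'`.

## References

* P. Nolin, Near-critical percolation in two dimensions, *Electron. J. Probab.* 13 (2008)
  1562–1623, §5.2, proof of Thm. 24 (ii) (arXiv 0711.4948: Thm. 23 (ii), p. 17) [Nolin2008].
* W. Werner, *Lectures on two-dimensional critical percolation*, IAS/Park City Math. Ser. 16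
  (2009), Lecture 6, §3; first exercise sheet, "Five-arm exponent" [WernerPCMI2009].
* H. Kesten, *Percolation theory for mathematicians*, Birkhäuser (1982), §2.2–2.3 [KestenPTM1982].

## Mathlib / tree

Tree: `exists_lr_subset_explored`, `mem_explored`, `mem_botCluster`, `botCluster_subset`,
`botCluster_subset_explored`, `bottomSide_subset_explored` (`TriLowestCrossingSwitch.lean`),
`PathIn.tri_crossings_meet` (`TriCrossingsMeet.lean`), `triGraph_adj_coord` (`TriHexLemma.lean`),
`FiveArmFrontier.lean`, `FiveArmSite.lean`.
-/

noncomputable section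

open Set

namespace Literature.Probability.Percolation

open LatticeModels

variable {M N : ℕ} {ω : Set (Site 2)}

/-- An open (resp. closed) path off the explored set from the top side down to a neighbour `g` of
an explored site `e` produces an open (resp. closed) foot of any open left–right sequence inside the
explored set, at `e`. [cite: Nolin2008, §5.2, proof of Thm. 24 (ii) (arXiv 0711.4948: p. 17)] -/
theorem LowSeq.exists_foot_of_pathIn {κ : ℕ → Site 2} {n : ℕ} (h : LowSeq M N ω κ n)
    (C : Set (Site 2)) {t g e : Site 2} (ht : t ∈ topSide M N) (he : e ∈ explored M N ω)
    (hge : triGraph.Adj g e)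
    (hp : PathIn triGraph ((↑(rectangle M N) \ ↑(explored M N ω)) ∩ C) t g) :
    ∃ k, k ≤ n ∧ κ k = e ∧ g ∈ aboveSet M N ω ∧ g ∈ C ∧
      PathIn triGraph (aboveSet M N ω ∩ C) g t := by
  have hgt : PathIn triGraph ((↑(rectangle M N) \ ↑(explored M N ω)) ∩ C) g t := hp.symm
  have hgA : g ∈ aboveSet M N ω := ⟨t, ht, hgt.mono inter_subset_left⟩
  obtain ⟨k, hk, hke⟩ := h.exists_eq_of_adj_aboveSet he hgA hge.symm
  refine ⟨k, hk, hke, hgA, hgt.left_mem.2, ?_⟩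
  exact hgt.pathIn_cluster.mono fun z (hz : PathIn triGraph _ g z) =>
    ⟨⟨t, ht, (hz.symm.trans hgt).mono inter_subset_left⟩, hz.right_mem.2⟩

/-- **The five arms at a double foot of the lowest crossing** (Nolin 2008, proof of Thm. 24 (ii),
arXiv p. 17; Werner 2009, first exercise sheet, "Five-arm exponent"). See the module docstring for
the statement; `S₀, S₁` are the two halves of the lowest crossing at `v`, `S₂`/`S₄` the open/closed
arm to the top side inside the region above, `S₃` the closed cluster below `v`. [cite: Nolin2008, §5.2, proof of Thm. 24 (ii) (arXiv 0711.4948: Thm. 23 (ii), p. 17)] [cite: WernerPCMI2009, Lecture 2, first exercise sheet ("Five-arm exponent", 3))] -/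
theorem exists_fiveArms {a₁ b₁ a₂ b₂ : ℤ} (ha₁ : 2 ≤ a₁) (hb₁ : b₁ + 2 ≤ M) (ha₂ : 2 ≤ a₂)
    (hb₂ : b₂ + 2 ≤ M) (hLR : LRPathIn M N ω) (hξ : LRPathIn M N ωᶜ)
    (htop : ∀ t ∈ topSide M N, t ∉ explored M N ω)
    (hO : ∃ t ∈ topSide M N, ∃ g e : Site 2, e ∈ explored M N ω ∧ triGraph.Adj g e ∧
      (a₁ ≤ g 0 ∧ g 0 ≤ b₁) ∧ PathIn triGraph ((↑(rectangle M N) \ ↑(explored M N ω)) ∩ ω) t g)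
    (hK : ∃ t ∈ topSide M N, ∃ g e : Site 2, e ∈ explored M N ω ∧ triGraph.Adj g e ∧
      (a₂ ≤ g 0 ∧ g 0 ≤ b₂) ∧ PathIn triGraph ((↑(rectangle M N) \ ↑(explored M N ω)) ∩ ωᶜ) t g) :
    ∃ v ∈ explored M N ω, ∃ S₀ S₁ S₂ S₃ S₄ : Set (Site 2),
      Disjoint S₀ S₁ ∧ S₀ ⊆ ↑(explored M N ω) ∩ ω ∧ S₁ ⊆ ↑(explored M N ω) ∩ ω ∧
      S₂ ⊆ aboveSet M N ω ∩ ω ∧ S₃ ⊆ ↑(explored M N ω) ∩ ωᶜ ∧ S₄ ⊆ aboveSet M N ω ∩ ωᶜ ∧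
      -- the two halves of the lowest crossing
      (∀ S, (S = S₀ ∨ S = S₁) → ∃ w ∈ S, triGraph.Adj v w ∧
        (∃ s, PathIn triGraph S w s ∧ (s 0 = 0 ∨ s 0 = M)) ∧
        ((∃ s, PathIn triGraph S w s ∧
            ((a₁ - 1 ≤ s 0 ∧ s 0 ≤ b₁ + 1) ∨ (a₂ - 1 ≤ s 0 ∧ s 0 ≤ b₂ + 1))) ∨
          ((a₁ - 1 ≤ v 0 ∧ v 0 ≤ b₁ + 1) ∨ (a₂ - 1 ≤ v 0 ∧ v 0 ≤ b₂ + 1)))) ∧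
      -- the two arms to the top side
      (∀ S, (S = S₂ ∨ S = S₄) → ∃ w ∈ S, triGraph.Adj v w ∧ ∃ s, PathIn triGraph S w s ∧ s 1 = N) ∧
      -- the closed arm below, reaching both vertical sides
      (∃ w ∈ S₃, triGraph.Adj v w ∧ ∃ s s', PathIn triGraph S₃ w s ∧ PathIn triGraph S₃ w s' ∧
        s 0 = 0 ∧ s' 0 = M) := by
  /- the lowest crossing as an open left–right sequence inside the explored set -/
  obtain ⟨x, y, hx0, hyM, hp⟩ := exists_lr_subset_explored hLR
  obtain ⟨n, κ, hκ, hκ0, hκn⟩ := exists_simpleSeq_of_pathIn hp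
  have hL : LowSeq M N ω κ n :=
    ⟨hκ.mono fun z hz => ⟨hz.2.2, hz.2.1⟩, Or.inl ⟨by rw [hκ0]; exact hx0, by rw [hκn]; exact hyM⟩⟩
  have hends : ∀ k, k ≤ n → (κ k 0 = 0 ∨ κ k 0 = M) ∨ (1 ≤ k ∧ k + 1 ≤ n) := by
    intro k hk
    rcases Nat.eq_zero_or_pos k with rfl | hk0
    · left; rcases hL.ends with ⟨h0, -⟩ | ⟨h0, -⟩
      · exact Or.inl h0
      · exact Or.inr h0
    · rcases eq_or_lt_of_le hk with rfl | hlt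
      · left; rcases hL.ends with ⟨-, h1⟩ | ⟨-, h1⟩
        · exact Or.inr h1
        · exact Or.inl h1
      · exact Or.inr ⟨hk0, hlt⟩
  /- the two feet -/
  obtain ⟨t₁, ht₁, g₁, e₁, he₁, hge₁, hcol₁, hp₁⟩ := hO
  obtain ⟨t₂, ht₂, g₂, e₂, he₂, hge₂, hcol₂, hp₂⟩ := hK
  obtain ⟨f₁, hf₁n, hf₁e, hg₁A, hg₁ω, hq₁⟩ := hL.exists_foot_of_pathIn ω ht₁ he₁ hge₁ hp₁
  obtain ⟨f₂, hf₂n, hf₂e, hg₂A, hg₂ω, hq₂⟩ := hL.exists_foot_of_pathIn ωᶜ ht₂ he₂ hge₂ hp₂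
  have hF₁ : IsFootO M N ω κ f₁ := ⟨g₁, hf₁e ▸ hge₁.symm, hg₁A, hg₁ω, t₁, ht₁, hq₁⟩
  have hF₂ : IsFootK M N ω κ f₂ := ⟨g₂, hf₂e ▸ hge₂.symm, hg₂A, hg₂ω, t₂, ht₂, hq₂⟩
  -- coordinates of the feet: within one column of the given columns, hence interior indices
  have hc₁ := triGraph_adj_coord hge₁ 0
  have hc₂ := triGraph_adj_coord hge₂ 0
  have hint : ∀ {f : ℕ} {e : Site 2} {a b : ℤ}, f ≤ n → κ f = e → 2 ≤ a → b + 2 ≤ (M : ℤ) →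
      a - 1 ≤ e 0 → e 0 ≤ b + 1 → 1 ≤ f ∧ f + 1 ≤ n := by
    intro f e a b hfn hfe ha hb h1 h2
    rcases hends f hfn with (h | h) | h
    · rw [hfe] at h; omega
    · rw [hfe] at h; omega
    · exact h
  have hi₁ := hint hf₁n hf₁e ha₁ hb₁ (by omega) (by omega)
  have hi₂ := hint hf₂n hf₂e ha₂ hb₂ (by omega) (by omega)
  /- the double foot -/
  obtain ⟨i, himin, himax, ⟨o, hio, hoA, hoω, t, ht, hot⟩, ⟨u, hiu, huA, huω, t', ht', hut'⟩⟩ :=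
    hL.exists_doubleFoot' htop hf₁n hf₂n hF₁ hF₂
  have hi1 : 1 ≤ i := le_trans (le_min hi₁.1 hi₂.1) himin
  have hin : i + 1 ≤ n := by
    rcases le_total f₁ f₂ with h12 | h12
    · rw [max_eq_right h12] at himax; omega
    · rw [max_eq_left h12] at himax; omega
  have hin' : i ≤ n := Nat.le_of_succ_le hin
  have hv := hL.mem hin'
  /- the closed arm below: the closed cluster of a closed neighbour of `κ i`, which meets `ξ` -/
  -- `κ i` is not on the bottom side (its open path to the top would meet the closed crossing)
  obtain ⟨xξ, yξ, hxξ, hyξ, hpξ⟩ := hξ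
  have ht1 : t 1 = N := (mem_coe_topSide.1 (Finset.mem_coe.2 ht)).2
  have hup : PathIn triGraph ({κ i} ∪ (aboveSet M N ω ∩ ω)) (κ i) t := by
    have h1 : κ i ∈ ({κ i} ∪ (aboveSet M N ω ∩ ω) : Set (Site 2)) := Or.inl (mem_singleton _)
    have h2 : o ∈ ({κ i} ∪ (aboveSet M N ω ∩ ω) : Set (Site 2)) := Or.inr hot.left_mem
    exact (PathIn.of_adj h1 h2 hio).trans (hot.mono subset_union_right)
  have hupR : {κ i} ∪ (aboveSet M N ω ∩ ω) ⊆ ↑(rectangle M N) := by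
    rintro z (hz | hz)
    · rw [mem_singleton_iff.1 hz]; exact Finset.mem_coe.2 hv.2.2
    · exact LowSeq.aboveSet_subset_rectangle hz.1
  have hvbot : κ i ∉ bottomSide M N := by
    intro hvb
    obtain ⟨z, hz, hz'⟩ := PathIn.tri_crossings_meet (L := 0) (R := M) (B := 0) (T := N)
      (coord_of_subset_rectangle (inter_subset_left (t := ωᶜ)))
      (coord_of_subset_rectangle hupR) hpξ hxξ hyξ hup
      (mem_coe_bottomSide.1 (Finset.mem_coe.2 hvb)).2 ht1
    rcases hz' with hz' | hz'
    · exact hz.2 (mem_singleton_iff.1 hz' ▸ hv.2.1)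
    · exact hz.2 hz'.2
  -- a closed neighbour `c` in the closed cluster of the bottom side
  obtain ⟨c, hc, hci⟩ : ∃ c ∈ botCluster M N ω, triGraph.Adj c (κ i) := by
    obtain ⟨-, hcase⟩ := mem_explored.1 hv.1
    rcases hcase with hb | ⟨c, hc, hc' | hci⟩
    · exact absurd hb hvbot
    · exact absurd hv.2.1 (hc' ▸ (botCluster_subset hc).2)
    · exact ⟨c, hc, hci⟩
  obtain ⟨b, hb, hbc⟩ := mem_botCluster.1 hc
  set S₃ : Set (Site 2) := {z | PathIn triGraph (↑(rectangle M N) ∩ ωᶜ) c z} with hS₃def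
  have hS₃sub : S₃ ⊆ ↑(explored M N ω) ∩ ωᶜ := fun z hz =>
    ⟨botCluster_subset_explored ⟨b, hb, hbc.trans hz⟩, hz.right_mem.2⟩
  -- the closed cluster of `c` meets `ξ`
  have hmeetξ : ∃ z ∈ S₃, PathIn triGraph (↑(rectangle M N) ∩ ωᶜ) xξ z := by
    have hdown : PathIn triGraph (S₃ ∪ ({κ i} ∪ (aboveSet M N ω ∩ ω))) b t := by
      have h1 : PathIn triGraph S₃ b c := by
        have := hbc.symm.pathIn_cluster
        exact this.symm
      exact ((h1.mono subset_union_left).tail hci (Or.inr (Or.inl (mem_singleton _)))).trans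
        (hup.mono subset_union_right)
    have hR : S₃ ∪ ({κ i} ∪ (aboveSet M N ω ∩ ω)) ⊆ ↑(rectangle M N) :=
      union_subset (fun z hz => hz.right_mem.1) hupR
    obtain ⟨S, hSsub, hSπ, hS⟩ := hpξ.exists_support
    obtain ⟨z, hzS, hz'⟩ := PathIn.tri_crossings_meet (L := 0) (R := M) (B := 0) (T := N)
      (coord_of_subset_rectangle (hSsub.trans inter_subset_left)) (coord_of_subset_rectangle hR)
      hSπ hxξ hyξ hdown (mem_coe_bottomSide.1 (Finset.mem_coe.2 hb)).2 ht1
    rcases hz' with hz' | hz' | hz'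
    · exact ⟨z, hz', (hS z hzS).mono hSsub⟩
    · exact absurd (mem_singleton_iff.1 hz' ▸ hv.2.1) (hSsub hzS).2
    · exact absurd hz'.2 (hSsub hzS).2
  obtain ⟨zξ, hzξ, hxz⟩ := hmeetξ
  /- the five sets -/
  set S₀ : Set (Site 2) := {z | ∃ k, k ≤ n ∧ k < i ∧ κ k = z} with hS₀def
  set S₁ : Set (Site 2) := {z | ∃ k, k ≤ n ∧ i < k ∧ κ k = z} with hS₁def
  set S₂ : Set (Site 2) := {z | PathIn triGraph (aboveSet M N ω ∩ ω) o z} with hS₂def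
  set S₄ : Set (Site 2) := {z | PathIn triGraph (aboveSet M N ω ∩ ωᶜ) u z} with hS₄def
  have hS₀sub : S₀ ⊆ ↑(explored M N ω) ∩ ω := by rintro z ⟨k, hk, -, rfl⟩; exact hL.seq.mem k hk
  have hS₁sub : S₁ ⊆ ↑(explored M N ω) ∩ ω := by rintro z ⟨k, hk, -, rfl⟩; exact hL.seq.mem k hk
  -- the horizontal reaches
  have hnear : ∀ {f : ℕ}, min f₁ f₂ ≤ f → f ≤ max f₁ f₂ → (f = f₁ ∨ f = f₂) →
      (a₁ - 1 ≤ κ f 0 ∧ κ f 0 ≤ b₁ + 1) ∨ (a₂ - 1 ≤ κ f 0 ∧ κ f 0 ≤ b₂ + 1) := by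
    rintro f - - (rfl | rfl)
    · left; rw [hf₁e]; omega
    · right; rw [hf₂e]; omega
  refine ⟨κ i, hv.1, S₀, S₁, S₂, S₃, S₄, ?_, hS₀sub, hS₁sub, fun z hz => hz.right_mem, hS₃sub,
    fun z hz => hz.right_mem, ?_, ?_, ?_⟩
  · -- `S₀ ∩ S₁ = ∅`
    rw [Set.disjoint_left]
    rintro z ⟨k, hk, hki, rfl⟩ ⟨l, hl, hil, hkl⟩
    have := hL.seq.inj l k hl hk hkl
    omega
  · -- the two halves of `κ`
    have hlo : min f₁ f₂ = f₁ ∨ min f₁ f₂ = f₂ := by rcases le_total f₁ f₂ with h | h <;> simp [h]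
    have hhi : max f₁ f₂ = f₁ ∨ max f₁ f₂ = f₂ := by rcases le_total f₁ f₂ with h | h <;> simp [h]
    rintro S (rfl | rfl)
    · -- `S₀`: indices `< i`, from `κ (i-1)` down to `κ 0` and to `κ (min f₁ f₂)`
      have hmemS : ∀ k, 0 ≤ k → k ≤ i - 1 → κ k ∈ S₀ := fun k _ hk => ⟨k, by omega, by omega, rfl⟩
      have hadj : triGraph.Adj (κ i) (κ (i - 1)) := by
        have := hL.seq.adj (i - 1) (by omega)
        rw [Nat.sub_add_cancel hi1] at this
        exact this.symm
      refine ⟨κ (i - 1), ⟨i - 1, by omega, by omega, rfl⟩, hadj,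
        ⟨κ 0, hL.seq.pathIn_seg' (Nat.zero_le _) (by omega) hmemS, ?_⟩, ?_⟩
      · rcases hends 0 (Nat.zero_le _) with h | h
        · exact h
        · omega
      · rcases eq_or_lt_of_le himin with heq | hlt
        · have := hnear (f := min f₁ f₂) le_rfl min_le_max hlo
          rw [heq] at this
          exact Or.inr this
        · refine Or.inl ⟨κ (min f₁ f₂), hL.seq.pathIn_seg' (a := min f₁ f₂) (b := i - 1)
            (by omega) (by omega) fun k hk hk' => ⟨k, by omega, by omega, rfl⟩, ?_⟩
          exact hnear le_rfl (le_trans hlt.le himax) hlo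
    · -- `S₁`: indices `> i`, from `κ (i+1)` up to `κ n` and to `κ (max f₁ f₂)`
      refine ⟨κ (i + 1), ⟨i + 1, hin, Nat.lt_succ_self i, rfl⟩, hL.seq.adj i hin,
        ⟨κ n, hL.seq.pathIn_seg hin le_rfl fun k hk hkn => ⟨k, hkn, by omega, rfl⟩, ?_⟩, ?_⟩
      · rcases hends n le_rfl with h | h
        · exact h
        · omega
      · rcases eq_or_lt_of_le himax with heq | hlt
        · have := hnear (f := max f₁ f₂) min_le_max le_rfl hhi
          rw [← heq] at this
          exact Or.inr this
        · refine Or.inl ⟨κ (max f₁ f₂), hL.seq.pathIn_seg (a := i + 1) (b := max f₁ f₂) hlt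
            (max_le hf₁n hf₂n) fun k hk hk' => ⟨k, le_trans hk' (max_le hf₁n hf₂n), by omega, rfl⟩,
            ?_⟩
          exact hnear (le_trans himin hlt.le) le_rfl hhi
  · -- the two arms to the top side
    rintro S (rfl | rfl)
    · exact ⟨o, PathIn.refl hot.left_mem, hio, t, hot.pathIn_cluster, ht1⟩
    · exact ⟨u, PathIn.refl hut'.left_mem, hiu, t', hut'.pathIn_cluster,
        (mem_coe_topSide.1 (Finset.mem_coe.2 ht')).2⟩
  · -- the closed arm below reaches both vertical sides along `ξ`
    have hcz : PathIn triGraph (↑(rectangle M N) ∩ ωᶜ) c zξ := hzξ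
    have hcx : PathIn triGraph (↑(rectangle M N) ∩ ωᶜ) c xξ := hcz.trans hxz.symm
    have hcy : PathIn triGraph (↑(rectangle M N) ∩ ωᶜ) c yξ := hcx.trans hpξ
    exact ⟨c, PathIn.refl hbc.right_mem, hci.symm, xξ, yξ, hcx.pathIn_cluster, hcy.pathIn_cluster,
      hxξ, hyξ⟩

end Literature.Probability.Percolation
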